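import Mathlib
import Summits.Ventures.PercRepro2.Defs
import Summits.Ventures.PercRepro2.Independence
import Summits.Ventures.PercRepro2.Harris
import Summits.Ventures.PercRepro2.CoinDefs
import Summits.Ventures.PercRepro2.CoinArcsOff
import Summits.Ventures.PercRepro2.CoinPendantDefs
import Summits.Ventures.PercRepro2.CoinPendant
import Summits.Ventures.PercRepro2.CoinInduced
import Summits.Ventures.PercRepro2.CoinVdBK
import Summits.Ventures.PercRepro2.CoinBHK
import Summits.Ventures.PercRepro2.CoinReverse
import Summits.Ventures.PercRepro2.CoinLemmaA
import Summits.Ventures.PercRepro2.CoinDarcMixed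
import Summits.Ventures.PercRepro2.CoinTwoPendantDefs
import Summits.Ventures.PercRepro2.CoinTwoPendantMass
import Summits.Ventures.PercRepro2.CoinTraceLevels
import Summits.Ventures.PercRepro2.CoinTraceTower
import Summits.Ventures.PercRepro2.CoinTracePin
import Summits.Ventures.PercRepro2.CoinTracePin2
import Summits.Ventures.PercRepro2.CoinTracePinTransfer
import Summits.Ventures.PercRepro2.CoinTraceReduce
import Summits.Ventures.PercRepro2.CoinTraceFn
import Summits.Ventures.PercRepro2.CoinTraceBlock
import Summits.Ventures.PercRepro2.CoinTraceShift
import Summits.Ventures.PercRepro2.CoinTwoStarAbstract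
import Summits.Ventures.PercRepro2.CoinTwoStar
import Summits.Ventures.PercRepro2.CoinTraceBlocks
import Summits.Ventures.PercRepro2.CoinTraceBlocks2
import Summits.Ventures.PercRepro2.CoinPathStarAbstract
import Summits.Ventures.PercRepro2.CoinPathStar
import Summits.Ventures.PercRepro2.CoinTwoChainsAbstract
import Summits.Ventures.PercRepro2.CoinTwoChains
import Summits.Ventures.PercRepro2.CoinLayerCake
import Summits.Ventures.PercRepro2.CoinTwoChainsHard
import Summits.Ventures.PercRepro2.CoinTwoChainsHardCD
import Summits.Ventures.PercRepro2.CoinTwoChainsAbstract2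
import Summits.Ventures.PercRepro2.CoinTwoChainsAll

/-!
# The literal TWO CHAINS OF LENGTH 2: six single-arc coins `w → v₁, v₁ → v₂, v₂ → t, w → v₃,
v₃ → v₄, v₄ → t` (blind cell PercRepro2, night-2 g4; proofs/NIGHT2-DARC.md §24.3)

`darc_of_twoChains_coins`: if the six coins are the ONLY coins with tails in `{w, v₁, v₂, v₃, v₄}`
(`OnlyTwoChainsCoins`; entries from outside arbitrary single arcs, the rest any `SameEnds` coin
system), then the structural hypotheses of `darc_of_twoChains_mixed` hold and row 2′DARC holds at
the head `w` on ALL regimes.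
-/

namespace Summit.Ventures.PercRepro2.Coin

section TwoChainsCoins

variable {V : Type*} {E : Type*} [DecidableEq V]

/-- The six coins are the only coins carrying an arc with tail in `{w, v₁, v₂, v₃, v₄}`. -/
def OnlyTwoChainsCoins (arcs : E → Finset (V × V)) (w v₁ v₂ v₃ v₄ : V) (e₁ e₂ e₃ e₄ e₅ e₆ : E) :
    Prop :=
  ∀ e, (∃ xy ∈ arcs e, xy.1 = w ∨ xy.1 = v₁ ∨ xy.1 = v₂ ∨ xy.1 = v₃ ∨ xy.1 = v₄) →
    e = e₁ ∨ e = e₂ ∨ e = e₃ ∨ e = e₄ ∨ e = e₅ ∨ e = e₆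

variable {arcs : E → Finset (V × V)} {w v₁ v₂ v₃ v₄ t : V} {e₁ e₂ e₃ e₄ e₅ e₆ : E}
  (h₁ : arcs e₁ = {(w, v₁)}) (h₂ : arcs e₂ = {(v₁, v₂)}) (h₃ : arcs e₃ = {(v₂, t)})
  (h₄ : arcs e₄ = {(w, v₃)}) (h₅ : arcs e₅ = {(v₃, v₄)}) (h₆ : arcs e₆ = {(v₄, t)})
  (honly : OnlyTwoChainsCoins arcs w v₁ v₂ v₃ v₄ e₁ e₂ e₃ e₄ e₅ e₆)

include h₁ h₂ h₃ h₄ h₅ h₆ honly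

omit [DecidableEq V] in
/-- An arc with tail in the pendant set is one of the six arcs. -/
lemma twoChains_arc {e : E} {x y : V} (hxy : (x, y) ∈ arcs e)
    (hx : x = w ∨ x = v₁ ∨ x = v₂ ∨ x = v₃ ∨ x = v₄) :
    (e = e₁ ∧ x = w ∧ y = v₁) ∨ (e = e₂ ∧ x = v₁ ∧ y = v₂) ∨ (e = e₃ ∧ x = v₂ ∧ y = t) ∨
      (e = e₄ ∧ x = w ∧ y = v₃) ∨ (e = e₅ ∧ x = v₃ ∧ y = v₄) ∨ (e = e₆ ∧ x = v₄ ∧ y = t) := by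
  rcases honly e ⟨(x, y), hxy, hx⟩ with rfl | rfl | rfl | rfl | rfl | rfl
  · rw [h₁, Finset.mem_singleton, Prod.mk.injEq] at hxy
    exact Or.inl ⟨rfl, hxy.1, hxy.2⟩
  · rw [h₂, Finset.mem_singleton, Prod.mk.injEq] at hxy
    exact Or.inr (Or.inl ⟨rfl, hxy.1, hxy.2⟩)
  · rw [h₃, Finset.mem_singleton, Prod.mk.injEq] at hxy
    exact Or.inr (Or.inr (Or.inl ⟨rfl, hxy.1, hxy.2⟩))
  · rw [h₄, Finset.mem_singleton, Prod.mk.injEq] at hxy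
    exact Or.inr (Or.inr (Or.inr (Or.inl ⟨rfl, hxy.1, hxy.2⟩)))
  · rw [h₅, Finset.mem_singleton, Prod.mk.injEq] at hxy
    exact Or.inr (Or.inr (Or.inr (Or.inr (Or.inl ⟨rfl, hxy.1, hxy.2⟩))))
  · rw [h₆, Finset.mem_singleton, Prod.mk.injEq] at hxy
    exact Or.inr (Or.inr (Or.inr (Or.inr (Or.inr ⟨rfl, hxy.1, hxy.2⟩))))

/-- The pendant set is closed out into `{t}`. -/
lemma twoChains_closedOut : ClosedOut arcs {w, v₁, v₂, v₃, v₄} {t} := by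
  intro e xy hxy hx
  simp only [Finset.mem_insert, Finset.mem_singleton] at hx
  rcases twoChains_arc h₁ h₂ h₃ h₄ h₅ h₆ honly hxy hx with ⟨_, _, hy⟩ | ⟨_, _, hy⟩ | ⟨_, _, hy⟩ |
    ⟨_, _, hy⟩ | ⟨_, _, hy⟩ | ⟨_, _, hy⟩ <;> simp [hy]

/-- The six coins carry only arcs with tails in the pendant set. -/
lemma twoChains_tailCoinsIn : TailCoinsIn arcs {w, v₁, v₂, v₃, v₄} {t} := by
  intro e he xy hxy
  obtain ⟨x'y', hx'y', hx'⟩ := he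
  simp only [Finset.mem_insert, Finset.mem_singleton] at hx'
  rcases twoChains_arc h₁ h₂ h₃ h₄ h₅ h₆ honly hx'y' hx' with ⟨rfl, _, _⟩ | ⟨rfl, _, _⟩ |
    ⟨rfl, _, _⟩ | ⟨rfl, _, _⟩ | ⟨rfl, _, _⟩ | ⟨rfl, _, _⟩
  · rw [h₁, Finset.mem_singleton] at hxy; subst hxy; simp
  · rw [h₂, Finset.mem_singleton] at hxy; subst hxy; simp
  · rw [h₃, Finset.mem_singleton] at hxy; subst hxy; simp
  · rw [h₄, Finset.mem_singleton] at hxy; subst hxy; simp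
  · rw [h₅, Finset.mem_singleton] at hxy; subst hxy; simp
  · rw [h₆, Finset.mem_singleton] at hxy; subst hxy; simp

omit h₁ h₃ h₄ h₅ h₆ honly in
/-- `e₂` (the coin `v₁ → v₂`) is a pendant coin. -/
lemma twoChains_e₂_mem : e₂ ∈ tailCoins arcs {w, v₁, v₂, v₃, v₄} :=
  ⟨(v₁, v₂), by rw [h₂]; exact Finset.mem_singleton_self _, by simp⟩

omit h₁ h₂ h₄ h₅ h₆ honly in
/-- `e₃` (the coin `v₂ → t`) is a pendant coin. -/
lemma twoChains_e₃_mem : e₃ ∈ tailCoins arcs {w, v₁, v₂, v₃, v₄} :=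
  ⟨(v₂, t), by rw [h₃]; exact Finset.mem_singleton_self _, by simp⟩

omit h₁ h₂ h₃ h₄ h₆ honly in
/-- `e₅` (the coin `v₃ → v₄`) is a pendant coin. -/
lemma twoChains_e₅_mem : e₅ ∈ tailCoins arcs {w, v₁, v₂, v₃, v₄} :=
  ⟨(v₃, v₄), by rw [h₅]; exact Finset.mem_singleton_self _, by simp⟩

omit h₁ h₂ h₃ h₄ h₅ honly in
/-- `e₆` (the coin `v₄ → t`) is a pendant coin. -/
lemma twoChains_e₆_mem : e₆ ∈ tailCoins arcs {w, v₁, v₂, v₃, v₄} :=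
  ⟨(v₄, t), by rw [h₆]; exact Finset.mem_singleton_self _, by simp⟩

omit [DecidableEq V] in
/-- The leaf `v₂` reaches `t` iff `e₃` is open. -/
lemma twoChains_leaf₂ (hwv₂ : w ≠ v₂) (hv₁₂ : v₁ ≠ v₂) (hv₂₃ : v₂ ≠ v₃) (hv₂₄ : v₂ ≠ v₄)
    (hv₂t : v₂ ≠ t) : bwdEvent arcs v₂ {t} = openEdge e₃ := by
  ext ω
  simp only [bwdEvent, Set.mem_setOf_eq, Finset.mem_singleton, exists_eq_left, openEdge]
  constructor
  · intro h
    rcases Relation.ReflTransGen.cases_head h with heq | ⟨y, ⟨e, he, hxy⟩, _⟩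
    · exact absurd heq hv₂t
    · rcases twoChains_arc h₁ h₂ h₃ h₄ h₅ h₆ honly hxy (Or.inr (Or.inr (Or.inl rfl))) with
        ⟨_, hx, _⟩ | ⟨_, hx, _⟩ | ⟨rfl, _, _⟩ | ⟨_, hx, _⟩ | ⟨_, hx, _⟩ | ⟨_, hx, _⟩
      · exact absurd hx.symm hwv₂
      · exact absurd hx.symm hv₁₂
      · exact he
      · exact absurd hx.symm hwv₂
      · exact absurd hx hv₂₃
      · exact absurd hx hv₂₄
  · intro h
    exact reach_of_openArc ⟨e₃, h, by rw [h₃]; exact Finset.mem_singleton_self _⟩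

omit [DecidableEq V] in
/-- The leaf `v₄` reaches `t` iff `e₆` is open. -/
lemma twoChains_leaf₄ (hwv₄ : w ≠ v₄) (hv₁₄ : v₁ ≠ v₄) (hv₂₄ : v₂ ≠ v₄) (hv₃₄ : v₃ ≠ v₄)
    (hv₄t : v₄ ≠ t) : bwdEvent arcs v₄ {t} = openEdge e₆ := by
  ext ω
  simp only [bwdEvent, Set.mem_setOf_eq, Finset.mem_singleton, exists_eq_left, openEdge]
  constructor
  · intro h
    rcases Relation.ReflTransGen.cases_head h with heq | ⟨y, ⟨e, he, hxy⟩, _⟩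
    · exact absurd heq hv₄t
    · rcases twoChains_arc h₁ h₂ h₃ h₄ h₅ h₆ honly hxy (Or.inr (Or.inr (Or.inr (Or.inr rfl)))) with
        ⟨_, hx, _⟩ | ⟨_, hx, _⟩ | ⟨_, hx, _⟩ | ⟨_, hx, _⟩ | ⟨_, hx, _⟩ | ⟨rfl, _, _⟩
      · exact absurd hx.symm hwv₄
      · exact absurd hx.symm hv₁₄
      · exact absurd hx.symm hv₂₄
      · exact absurd hx.symm hwv₄
      · exact absurd hx.symm hv₃₄
      · exact he
  · intro h
    exact reach_of_openArc ⟨e₆, h, by rw [h₆]; exact Finset.mem_singleton_self _⟩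

omit [DecidableEq V] in
/-- The inner vertex `v₁` reaches `t` iff `e₂` and `e₃` are open. -/
lemma twoChains_leaf₁ (hwv₁ : w ≠ v₁) (hwv₂ : w ≠ v₂) (hv₁₂ : v₁ ≠ v₂) (hv₁₃ : v₁ ≠ v₃)
    (hv₁₄ : v₁ ≠ v₄) (hv₂₃ : v₂ ≠ v₃) (hv₂₄ : v₂ ≠ v₄) (hv₁t : v₁ ≠ t) (hv₂t : v₂ ≠ t) :
    bwdEvent arcs v₁ {t} = openEdge e₂ ∩ openEdge e₃ := by
  ext ω
  simp only [bwdEvent, Set.mem_setOf_eq, Finset.mem_singleton, exists_eq_left, openEdge,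
    Set.mem_inter_iff]
  constructor
  · intro h
    rcases Relation.ReflTransGen.cases_head h with heq | ⟨y, ⟨e, he, hxy⟩, hyt⟩
    · exact absurd heq hv₁t
    · rcases twoChains_arc h₁ h₂ h₃ h₄ h₅ h₆ honly hxy (Or.inr (Or.inl rfl)) with
        ⟨_, hx, _⟩ | ⟨rfl, _, hy⟩ | ⟨_, hx, _⟩ | ⟨_, hx, _⟩ | ⟨_, hx, _⟩ | ⟨_, hx, _⟩
      · exact absurd hx.symm hwv₁
      · refine ⟨he, ?_⟩
        have h2 : ω ∈ bwdEvent arcs v₂ {t} := by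
          simp only [bwdEvent, Set.mem_setOf_eq, Finset.mem_singleton, exists_eq_left]
          rw [hy] at hyt
          exact hyt
        rw [twoChains_leaf₂ h₁ h₂ h₃ h₄ h₅ h₆ honly hwv₂ hv₁₂ hv₂₃ hv₂₄ hv₂t] at h2
        exact h2
      · exact absurd hx hv₁₂
      · exact absurd hx.symm hwv₁
      · exact absurd hx hv₁₃
      · exact absurd hx hv₁₄
  · rintro ⟨h2, h3⟩
    exact Relation.ReflTransGen.head ⟨e₂, h2, by rw [h₂]; exact Finset.mem_singleton_self _⟩
      (reach_of_openArc ⟨e₃, h3, by rw [h₃]; exact Finset.mem_singleton_self _⟩)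

omit [DecidableEq V] in
/-- The inner vertex `v₃` reaches `t` iff `e₅` and `e₆` are open. -/
lemma twoChains_leaf₃ (hwv₃ : w ≠ v₃) (hwv₄ : w ≠ v₄) (hv₁₃ : v₁ ≠ v₃) (hv₁₄ : v₁ ≠ v₄)
    (hv₂₃ : v₂ ≠ v₃) (hv₂₄ : v₂ ≠ v₄) (hv₃₄ : v₃ ≠ v₄) (hv₃t : v₃ ≠ t) (hv₄t : v₄ ≠ t) :
    bwdEvent arcs v₃ {t} = openEdge e₅ ∩ openEdge e₆ := by
  ext ω
  simp only [bwdEvent, Set.mem_setOf_eq, Finset.mem_singleton, exists_eq_left, openEdge,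
    Set.mem_inter_iff]
  constructor
  · intro h
    rcases Relation.ReflTransGen.cases_head h with heq | ⟨y, ⟨e, he, hxy⟩, hyt⟩
    · exact absurd heq hv₃t
    · rcases twoChains_arc h₁ h₂ h₃ h₄ h₅ h₆ honly hxy (Or.inr (Or.inr (Or.inr (Or.inl rfl)))) with
        ⟨_, hx, _⟩ | ⟨_, hx, _⟩ | ⟨_, hx, _⟩ | ⟨_, hx, _⟩ | ⟨rfl, _, hy⟩ | ⟨_, hx, _⟩
      · exact absurd hx.symm hwv₃
      · exact absurd hx.symm hv₁₃
      · exact absurd hx.symm hv₂₃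
      · exact absurd hx.symm hwv₃
      · refine ⟨he, ?_⟩
        have h4 : ω ∈ bwdEvent arcs v₄ {t} := by
          simp only [bwdEvent, Set.mem_setOf_eq, Finset.mem_singleton, exists_eq_left]
          rw [hy] at hyt
          exact hyt
        rw [twoChains_leaf₄ h₁ h₂ h₃ h₄ h₅ h₆ honly hwv₄ hv₁₄ hv₂₄ hv₃₄ hv₄t] at h4
        exact h4
      · exact absurd hx hv₃₄
  · rintro ⟨h5, h6⟩
    exact Relation.ReflTransGen.head ⟨e₅, h5, by rw [h₅]; exact Finset.mem_singleton_self _⟩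
      (reach_of_openArc ⟨e₆, h6, by rw [h₆]; exact Finset.mem_singleton_self _⟩)

omit [DecidableEq V] in
/-- `v₁ ∈ K⁻` forces `v₂ ∈ K⁻`. -/
lemma twoChains_imp₁₂ (hwv₁ : w ≠ v₁) (hwv₂ : w ≠ v₂) (hv₁₂ : v₁ ≠ v₂) (hv₁₃ : v₁ ≠ v₃)
    (hv₁₄ : v₁ ≠ v₄) (hv₂₃ : v₂ ≠ v₃) (hv₂₄ : v₂ ≠ v₄) (hv₁t : v₁ ≠ t) (hv₂t : v₂ ≠ t)
    (ω : Config E) (h : ω ∈ bwdEvent arcs v₁ {t}) : ω ∈ bwdEvent arcs v₂ {t} := by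
  rw [twoChains_leaf₁ h₁ h₂ h₃ h₄ h₅ h₆ honly hwv₁ hwv₂ hv₁₂ hv₁₃ hv₁₄ hv₂₃ hv₂₄ hv₁t hv₂t] at h
  rw [twoChains_leaf₂ h₁ h₂ h₃ h₄ h₅ h₆ honly hwv₂ hv₁₂ hv₂₃ hv₂₄ hv₂t]
  exact h.2

omit [DecidableEq V] in
/-- `v₃ ∈ K⁻` forces `v₄ ∈ K⁻`. -/
lemma twoChains_imp₃₄ (hwv₃ : w ≠ v₃) (hwv₄ : w ≠ v₄) (hv₁₃ : v₁ ≠ v₃) (hv₁₄ : v₁ ≠ v₄)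
    (hv₂₃ : v₂ ≠ v₃) (hv₂₄ : v₂ ≠ v₄) (hv₃₄ : v₃ ≠ v₄) (hv₃t : v₃ ≠ t) (hv₄t : v₄ ≠ t)
    (ω : Config E) (h : ω ∈ bwdEvent arcs v₃ {t}) : ω ∈ bwdEvent arcs v₄ {t} := by
  rw [twoChains_leaf₃ h₁ h₂ h₃ h₄ h₅ h₆ honly hwv₃ hwv₄ hv₁₃ hv₁₄ hv₂₃ hv₂₄ hv₃₄ hv₃t hv₄t] at h
  rw [twoChains_leaf₄ h₁ h₂ h₃ h₄ h₅ h₆ honly hwv₄ hv₁₄ hv₂₄ hv₃₄ hv₄t]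
  exact h.2

omit [DecidableEq V] in
/-- The head reaches `t` only through a full route. -/
lemma twoChains_head_exit (hwv₁ : w ≠ v₁) (hwv₂ : w ≠ v₂) (hwv₃ : w ≠ v₃) (hwv₄ : w ≠ v₄)
    (hv₁₂ : v₁ ≠ v₂) (hv₁₃ : v₁ ≠ v₃) (hv₁₄ : v₁ ≠ v₄) (hv₂₃ : v₂ ≠ v₃) (hv₂₄ : v₂ ≠ v₄)
    (hv₃₄ : v₃ ≠ v₄) (hwt : w ≠ t) (hv₁t : v₁ ≠ t) (hv₂t : v₂ ≠ t) (hv₃t : v₃ ≠ t)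
    (hv₄t : v₄ ≠ t) (ω : Config E) (h : ω ∈ bwdEvent arcs w {t}) :
    (ω ∈ bwdEvent arcs v₁ {t} ∧ ω ∈ bwdEvent arcs v₂ {t}) ∨
      (ω ∈ bwdEvent arcs v₃ {t} ∧ ω ∈ bwdEvent arcs v₄ {t}) := by
  have h' := h
  simp only [bwdEvent, Set.mem_setOf_eq, Finset.mem_singleton, exists_eq_left] at h'
  rcases Relation.ReflTransGen.cases_head h' with heq | ⟨y, ⟨e, _, hxy⟩, hyt⟩
  · exact absurd heq hwt
  · rcases twoChains_arc h₁ h₂ h₃ h₄ h₅ h₆ honly hxy (Or.inl rfl) with ⟨_, _, hy⟩ | ⟨_, hx, _⟩ |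
      ⟨_, hx, _⟩ | ⟨_, _, hy⟩ | ⟨_, hx, _⟩ | ⟨_, hx, _⟩
    · have h1 : ω ∈ bwdEvent arcs v₁ {t} := by
        simp only [bwdEvent, Set.mem_setOf_eq, Finset.mem_singleton, exists_eq_left]
        rw [hy] at hyt
        exact hyt
      exact Or.inl ⟨h1, twoChains_imp₁₂ h₁ h₂ h₃ h₄ h₅ h₆ honly hwv₁ hwv₂ hv₁₂ hv₁₃ hv₁₄ hv₂₃ hv₂₄
        hv₁t hv₂t ω h1⟩
    · exact absurd hx hwv₁
    · exact absurd hx hwv₂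
    · have h3 : ω ∈ bwdEvent arcs v₃ {t} := by
        simp only [bwdEvent, Set.mem_setOf_eq, Finset.mem_singleton, exists_eq_left]
        rw [hy] at hyt
        exact hyt
      exact Or.inr ⟨h3, twoChains_imp₃₄ h₁ h₂ h₃ h₄ h₅ h₆ honly hwv₃ hwv₄ hv₁₃ hv₁₄ hv₂₃ hv₂₄ hv₃₄
        hv₃t hv₄t ω h3⟩
    · exact absurd hx hwv₃
    · exact absurd hx hwv₄

end TwoChainsCoins

section Theorem

open Classical

variable {V : Type*} {E : Type*} [Fintype V] [DecidableEq V] [Fintype E] [DecidableEq E]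
  {R : Type*} [Field R] [LinearOrder R] [IsStrictOrderedRing R]

/-- **THEOREM (the literal two chains of length 2, row 2′DARC, ALL regimes).** -/
theorem darc_of_twoChains_coins (p : E → R) (hp : IsProbVec p) {arcs : E → Finset (V × V)}
    (hS : SameEnds arcs) (s a b u w v₁ v₂ v₃ v₄ t : V) (hwv₁ : w ≠ v₁) (hwv₂ : w ≠ v₂)
    (hwv₃ : w ≠ v₃) (hwv₄ : w ≠ v₄) (hv₁₂ : v₁ ≠ v₂) (hv₁₃ : v₁ ≠ v₃) (hv₁₄ : v₁ ≠ v₄)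
    (hv₂₃ : v₂ ≠ v₃) (hv₂₄ : v₂ ≠ v₄) (hv₃₄ : v₃ ≠ v₄) (hwt : w ≠ t) (hv₁t : v₁ ≠ t)
    (hv₂t : v₂ ≠ t) (hv₃t : v₃ ≠ t) (hv₄t : v₄ ≠ t) {e₁ e₂ e₃ e₄ e₅ e₆ : E} (hne₂₃ : e₂ ≠ e₃)
    (hne₅₆ : e₅ ≠ e₆) (h₁ : arcs e₁ = {(w, v₁)}) (h₂ : arcs e₂ = {(v₁, v₂)})
    (h₃ : arcs e₃ = {(v₂, t)}) (h₄ : arcs e₄ = {(w, v₃)}) (h₅ : arcs e₅ = {(v₃, v₄)})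
    (h₆ : arcs e₆ = {(v₄, t)}) (honly : OnlyTwoChainsCoins arcs w v₁ v₂ v₃ v₄ e₁ e₂ e₃ e₄ e₅ e₆)
    (ha : a ∉ ({w, v₁, v₂, v₃, v₄} : Finset V) ∪ {t}) (hb : b ∉ ({w, v₁, v₂, v₃, v₄} : Finset V) ∪ {t})
    (hu : u ∉ ({w, v₁, v₂, v₃, v₄} : Finset V) ∪ {t})
    (hP : ∀ Z ∈ ({w, v₁, v₂, v₃, v₄} : Finset V).powerset,
      0 < prob p (avoidEvent (arcsOff arcs ({w, v₁, v₂, v₃, v₄} ∪ {t})) s (Z ∪ {t})))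
    (hQ : ∀ Z ∈ ({w, v₁, v₂, v₃, v₄} : Finset V).powerset,
      0 < prob p (avoidEvent (arcsOff arcs ({w, v₁, v₂, v₃, v₄} ∪ {t})) s (gateTarget u w Z {t}))) :
    DARC p arcs s {t} a b u w :=
  darc_of_twoChains_mixed p hp hS s a b u w v₁ v₂ v₃ v₄ t hwv₁ hwv₂ hwv₃ hwv₄ hv₁₂ hv₁₃ hv₁₄ hv₂₃
    hv₂₄ hv₃₄ (twoChains_closedOut h₁ h₂ h₃ h₄ h₅ h₆ honly)
    (twoChains_tailCoinsIn h₁ h₂ h₃ h₄ h₅ h₆ honly) hne₂₃ hne₅₆ (twoChains_e₂_mem h₂)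
    (twoChains_e₃_mem h₃) (twoChains_e₅_mem h₅) (twoChains_e₆_mem h₆)
    (twoChains_leaf₁ h₁ h₂ h₃ h₄ h₅ h₆ honly hwv₁ hwv₂ hv₁₂ hv₁₃ hv₁₄ hv₂₃ hv₂₄ hv₁t hv₂t)
    (twoChains_leaf₂ h₁ h₂ h₃ h₄ h₅ h₆ honly hwv₂ hv₁₂ hv₂₃ hv₂₄ hv₂t)
    (twoChains_leaf₃ h₁ h₂ h₃ h₄ h₅ h₆ honly hwv₃ hwv₄ hv₁₃ hv₁₄ hv₂₃ hv₂₄ hv₃₄ hv₃t hv₄t)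
    (twoChains_leaf₄ h₁ h₂ h₃ h₄ h₅ h₆ honly hwv₄ hv₁₄ hv₂₄ hv₃₄ hv₄t)
    (twoChains_imp₁₂ h₁ h₂ h₃ h₄ h₅ h₆ honly hwv₁ hwv₂ hv₁₂ hv₁₃ hv₁₄ hv₂₃ hv₂₄ hv₁t hv₂t)
    (twoChains_imp₃₄ h₁ h₂ h₃ h₄ h₅ h₆ honly hwv₃ hwv₄ hv₁₃ hv₁₄ hv₂₃ hv₂₄ hv₃₄ hv₃t hv₄t)
    (twoChains_head_exit h₁ h₂ h₃ h₄ h₅ h₆ honly hwv₁ hwv₂ hwv₃ hwv₄ hv₁₂ hv₁₃ hv₁₄ hv₂₃ hv₂₄ hv₃₄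
      hwt hv₁t hv₂t hv₃t hv₄t)
    ha hb hu hP hQ

end Theorem

end Summit.Ventures.PercRepro2.Coin
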